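import Literature.MathematicalPhysics.QuantumFieldTheory.ConformalBootstrap3D.PointKernelK34v2Data
import Literature.MathematicalPhysics.QuantumFieldTheory.ConformalBootstrap3D.PointKernelParts

/-!
# K34v2 certificate, kernel part file P74: one-cell head segments 191, 192, 193 in level ranges

The head cells whose kernel evaluation exceeds one `decide` are one-cell segments of `hsegsK34v2`; each is
checked by `PCert.hPartSideOK` (side conditions) and `PCert.hPartOK` per level range `[n_lo, n_lo + count)`
against an integer claim, the claims summing to `≥ 0` (`PointKernel.partsOK`); soundness is
`PCert.hParts_sound` (`PointKernelParts`).  The part files `P1, P2, …` are mutually independent (each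
imports only the data file); the ranges of one cell may span several of them, and the per-cell
conclusions `hparts_i` / `hcell_i` of those cells are assembled in `PointKernelK34v2.lean`.
Estimated kernel time 160 s.
-/

set_option maxRecDepth 100000
set_option maxHeartbeats 0

namespace Literature.MathematicalPhysics.QuantumFieldTheory.ConformalBootstrap3D.PointKernelK34v2

open Literature.MathematicalPhysics.QuantumFieldTheory.ConformalBootstrap3D.PointKernel

/-- levels `[0, 29)` of segment 191: partial lower sum `≥` claim. [folklore] -/
theorem part_191_0 : certK34v2.hPartOK (PCert.segAt hsegsK34v2 191) JHK34v2 0 29 (0) = true := by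
  decide +kernel

/-- one-cell segment 192 (row 6, cell `[231/32, 29/4]`, chord, `n_F = 32`,
1 level ranges): side conditions. [folklore] -/
theorem pside_192 : certK34v2.hPartSideOK (PCert.segAt hsegsK34v2 192) JHK34v2 = true := by
  decide +kernel

/-- its level ranges `(n_lo, count, claim)`. [folklore] -/
def parts_192 : List (ℕ × ℕ × ℤ) := [(0, 33, 0)]

/-- the ranges tile `[0, n_F]` and the claims sum to `≥ 0`. [folklore] -/
theorem pcov_192 : PointKernel.partsOK 32 parts_192 = true := by
  decide +kernel

/-- levels `[0, 33)` of segment 192: partial lower sum `≥` claim. [folklore] -/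
theorem part_192_0 : certK34v2.hPartOK (PCert.segAt hsegsK34v2 192) JHK34v2 0 33 (0) = true := by
  decide +kernel

/-- one-cell segment 193 (row 6, cell `[29/4, 233/32]`, chord, `n_F = 28`,
1 level ranges): side conditions. [folklore] -/
theorem pside_193 : certK34v2.hPartSideOK (PCert.segAt hsegsK34v2 193) JHK34v2 = true := by
  decide +kernel

/-- its level ranges `(n_lo, count, claim)`. [folklore] -/
def parts_193 : List (ℕ × ℕ × ℤ) := [(0, 29, 0)]

/-- the ranges tile `[0, n_F]` and the claims sum to `≥ 0`. [folklore] -/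
theorem pcov_193 : PointKernel.partsOK 28 parts_193 = true := by
  decide +kernel

/-- levels `[0, 29)` of segment 193: partial lower sum `≥` claim. [folklore] -/
theorem part_193_0 : certK34v2.hPartOK (PCert.segAt hsegsK34v2 193) JHK34v2 0 29 (0) = true := by
  decide +kernel

end Literature.MathematicalPhysics.QuantumFieldTheory.ConformalBootstrap3D.PointKernelK34v2
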